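import Summits.NavierStokesRegularity.NavierStokesRegularity.Theorems.ExtremiserTransienceNearExtremalTransienceExtremiserLiouvilleConstantSpeedEnergyFluxInvariance
import Mathlib.MeasureTheory.Integral.IntervalIntegral.FundThmCalculus
import HarnessLib

/-!
# Crux `ExtremiserTransience.NearExtremalTransience` (stmt-NavierStokesRegularity-21883), line `extremiser_liouville`,
# stub K1b — LINEAR GROWTH OF THE SLAB ENERGIES of the residue object

`--supports stmt-NavierStokesRegularity-21883` (helper).  Author: prover seat `ns-el-k1b` (g5).  Continues
`…ConstantSpeedEnergyFluxInvariance` (`∫ θ′(x₂)‖V‖² = 0` for every axial test `θ ∈ C¹_c`).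

For `V = w − c ∈ C¹` divergence free with `⟪V, c⟫ = −‖V‖²/2`, `c = (0,0,c₂) ≠ 0`, `‖V‖² ∈ L¹({|x₂| ≤ T})`, and the smooth
flat-free bump `B := H − H(· − 1)` (`H = Real.smoothTransition`; `0 ≤ B ≤ 1`, `B = 0` off `(0,2)`):

* `exists_axialTest_deriv_eq_bump_sub_bump` : an axial test `θ ∈ C¹_c` with `θ′ = B(· − s) − B(· − t)` (fundamental theorem
  of calculus; `∫ (B(· − s) − B(· − t)) = 0` makes the primitive compactly supported);
* `integral_bump_window_mul_sq_eq` : the BUMP-WINDOW ENERGIES `F(s) := ∫ B(x₂ − s)‖V x‖² dx` do not depend on `s`;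
* `integral_step_window_mul_sq_eq` : **`∫ (H(x₂ − s) − H(x₂ − s − N))‖V x‖² dx = N · F(0)`** for `N ∈ ℕ` (telescoping
  `H − H(· − N) = Σ_{k<N} B(· − k)`): the energy of `w − c` in an axial slab grows LINEARLY with the slab length;
* `integral_indicator_slab_mul_sq_le` / `le_integral_indicator_slab_mul_sq` : the sandwich
  `∫_{s+1 ≤ x₂ ≤ s+N}‖V‖² ≤ N·F(0) ≤ ∫_{s ≤ x₂ ≤ s+N+1}‖V‖²`.

READING for K1b (record `Lines/extremiser_liouville_k1b_jet.md` §5): in the JET alternative every slab of axial length `N`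
carries energy `N·F(0) + O(F(0))`, `F(0) > 0`; this is the input "`∫_{slab}‖V‖² = L·E₀`" of the truncation estimates.

WHAT THIS IS NOT: K1b is NOT proved; nothing here proves NS regularity. [folklore]
-/

noncomputable section

open Set Filter Topology MeasureTheory Metric Function
open scoped ENNReal NNReal Topology InnerProductSpace RealInnerProductSpace ContDiff
open Literature.Analysis.FluidPDE Literature.Analysis

namespace Summit.NavierStokesRegularity.NavierStokesRegularity.Theorems

-- the problem directory repeats the summit name (`NavierStokesRegularity/NavierStokesRegularity`)
set_option linter.dupNamespace false

namespace ExtremiserLiouville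

variable {V : EuclideanSpace ℝ (Fin 3) → EuclideanSpace ℝ (Fin 3)} {c : EuclideanSpace ℝ (Fin 3)}

/-! ## The bump `B = H − H(· − 1)` -/

/-- `0 ≤ H(w) − H(w − 1)`. [folklore] -/
theorem smoothTransition_sub_nonneg (w : ℝ) : 0 ≤ Real.smoothTransition w - Real.smoothTransition (w - 1) :=
  sub_nonneg.2 (Real.smoothTransition.monotone (by linarith))

/-- `H(w) − H(w − 1) ≤ 1`. [folklore] -/
theorem smoothTransition_sub_le_one (w : ℝ) : Real.smoothTransition w - Real.smoothTransition (w - 1) ≤ 1 := by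
  linarith [Real.smoothTransition.le_one w, Real.smoothTransition.nonneg (w - 1)]

/-- `H(w) − H(w − 1) = 0` for `w ≤ 0`. [folklore] -/
theorem smoothTransition_sub_of_nonpos {w : ℝ} (hw : w ≤ 0) :
    Real.smoothTransition w - Real.smoothTransition (w - 1) = 0 := by
  rw [Real.smoothTransition.zero_of_nonpos hw, Real.smoothTransition.zero_of_nonpos (by linarith), sub_self]

/-- `H(w) − H(w − 1) = 0` for `2 ≤ w`. [folklore] -/
theorem smoothTransition_sub_of_two_le {w : ℝ} (hw : 2 ≤ w) :
    Real.smoothTransition w - Real.smoothTransition (w - 1) = 0 := by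
  rw [Real.smoothTransition.one_of_one_le (by linarith), Real.smoothTransition.one_of_one_le (by linarith), sub_self]

/-- If `H(w) − H(w − 1) ≠ 0` then `0 < w < 2`. [folklore] -/
theorem pos_and_lt_two_of_smoothTransition_sub_ne_zero {w : ℝ}
    (hw : Real.smoothTransition w - Real.smoothTransition (w - 1) ≠ 0) : 0 < w ∧ w < 2 := by
  constructor
  · by_contra h; exact hw (smoothTransition_sub_of_nonpos (not_lt.1 h))
  · by_contra h; exact hw (smoothTransition_sub_of_two_le (not_lt.1 h))

/-- The bump is continuous. [folklore] -/
theorem continuous_smoothTransition_sub :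
    Continuous fun w : ℝ => Real.smoothTransition w - Real.smoothTransition (w - 1) :=
  Real.smoothTransition.continuous.sub (Real.smoothTransition.continuous.comp (continuous_id.sub continuous_const))

/-- `∫_a^b B = ∫_0^2 B` whenever `a ≤ 0` and `2 ≤ b` (the bump vanishes off `(0,2)`). [folklore] -/
theorem intervalIntegral_smoothTransition_sub_eq {a b : ℝ} (ha : a ≤ 0) (hb : 2 ≤ b) :
    (∫ w in a..b, (Real.smoothTransition w - Real.smoothTransition (w - 1))) =
      ∫ w in (0 : ℝ)..2, (Real.smoothTransition w - Real.smoothTransition (w - 1)) := by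
  have hi : ∀ p q : ℝ, IntervalIntegrable (fun w : ℝ => Real.smoothTransition w - Real.smoothTransition (w - 1))
      volume p q := fun p q => continuous_smoothTransition_sub.intervalIntegrable p q
  have h1 : (∫ w in a..(0 : ℝ), (Real.smoothTransition w - Real.smoothTransition (w - 1))) = 0 := by
    rw [intervalIntegral.integral_congr (g := fun _ => (0 : ℝ)) fun w hw => ?_, intervalIntegral.integral_zero]
    rw [uIcc_of_le ha] at hw
    exact smoothTransition_sub_of_nonpos hw.2
  have h2 : (∫ w in (2 : ℝ)..b, (Real.smoothTransition w - Real.smoothTransition (w - 1))) = 0 := by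
    rw [intervalIntegral.integral_congr (g := fun _ => (0 : ℝ)) fun w hw => ?_, intervalIntegral.integral_zero]
    rw [uIcc_of_le hb] at hw
    exact smoothTransition_sub_of_two_le hw.1
  rw [← intervalIntegral.integral_add_adjacent_intervals (hi a 0) (hi 0 b),
    ← intervalIntegral.integral_add_adjacent_intervals (hi 0 2) (hi 2 b), h1, h2, zero_add, add_zero]

/-! ## An axial test with derivative `B(· − s) − B(· − t)` -/

/-- For all `s, t` there is an axial test `θ ∈ C¹(ℝ)` with **`θ′ = B(· − s) − B(· − t)`** vanishing for `z ≤ min s t` and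
for `max s t + 2 ≤ z` (`θ(z) = ∫_{min s t}^z (B(u − s) − B(u − t)) du`; the two bumps have the same mass, so the primitive
returns to zero). [folklore] -/
theorem exists_axialTest_deriv_eq_bump_sub_bump (s t : ℝ) :
    ∃ θ : ℝ → ℝ, ContDiff ℝ 1 θ ∧
      (∀ z, deriv θ z = (Real.smoothTransition (z - s) - Real.smoothTransition (z - s - 1)) -
        (Real.smoothTransition (z - t) - Real.smoothTransition (z - t - 1))) ∧
      (∀ z, z ≤ min s t → θ z = 0) ∧ (∀ z, max s t + 2 ≤ z → θ z = 0) := by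
  set f : ℝ → ℝ := fun z => (Real.smoothTransition (z - s) - Real.smoothTransition (z - s - 1)) -
    (Real.smoothTransition (z - t) - Real.smoothTransition (z - t - 1)) with hfdef
  have hB := continuous_smoothTransition_sub
  have hfs : Continuous fun z : ℝ => Real.smoothTransition (z - s) - Real.smoothTransition (z - s - 1) := by
    have := hB.comp (continuous_id.sub (continuous_const (y := s)))
    simpa [Function.comp_def, sub_sub] using this
  have hft : Continuous fun z : ℝ => Real.smoothTransition (z - t) - Real.smoothTransition (z - t - 1) := by
    have := hB.comp (continuous_id.sub (continuous_const (y := t)))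
    simpa [Function.comp_def, sub_sub] using this
  have hf : Continuous f := hfs.sub hft
  set m := min s t with hm
  refine ⟨fun z => ∫ u in m..z, f u, ?_, ?_, ?_, ?_⟩
  · -- `C¹`: differentiable with continuous derivative `f`
    rw [contDiff_one_iff_deriv]
    refine ⟨fun z => (hf.integral_hasStrictDerivAt m z).hasDerivAt.differentiableAt, ?_⟩
    have : deriv (fun z => ∫ u in m..z, f u) = f := funext fun z => hf.deriv_integral f m z
    rw [this]; exact hf
  · intro z; exact hf.deriv_integral f m z
  · -- below `min s t` the integrand vanishes
    intro z hz
    show (∫ u in m..z, f u) = 0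
    rw [intervalIntegral.integral_congr (g := fun _ => (0 : ℝ)) fun u hu => ?_, intervalIntegral.integral_zero]
    rw [uIcc_of_ge hz] at hu
    have hus : u - s ≤ 0 := by linarith [hu.2, min_le_left s t]
    have hut : u - t ≤ 0 := by linarith [hu.2, min_le_right s t]
    show (Real.smoothTransition (u - s) - Real.smoothTransition (u - s - 1)) -
      (Real.smoothTransition (u - t) - Real.smoothTransition (u - t - 1)) = 0
    rw [smoothTransition_sub_of_nonpos hus, smoothTransition_sub_of_nonpos hut, sub_self]
  · -- above `max s t + 2` both bumps have been fully integrated: equal masses cancel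
    intro z hz
    show (∫ u in m..z, f u) = 0
    have h1 : (∫ u in m..z, (Real.smoothTransition (u - s) - Real.smoothTransition (u - s - 1))) =
        ∫ w in (0 : ℝ)..2, (Real.smoothTransition w - Real.smoothTransition (w - 1)) := by
      have := intervalIntegral.integral_comp_sub_right
        (fun w => Real.smoothTransition w - Real.smoothTransition (w - 1)) s (a := m) (b := z)
      simp only [sub_sub] at this ⊢
      rw [show (fun u : ℝ => Real.smoothTransition (u - s) - Real.smoothTransition (u - (s + 1))) =
          fun u : ℝ => Real.smoothTransition (u - s) - Real.smoothTransition (u - s - 1) from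
          funext fun u => by rw [sub_sub]] at this
      rw [show (fun u : ℝ => Real.smoothTransition (u - s) - Real.smoothTransition (u - (s + 1))) =
          fun u : ℝ => Real.smoothTransition (u - s) - Real.smoothTransition (u - s - 1) from
          funext fun u => by rw [sub_sub]]
      rw [this]
      have h' := intervalIntegral_smoothTransition_sub_eq (a := m - s) (b := z - s)
        (by linarith [min_le_left s t]) (by linarith [le_max_left s t])
      simpa only [sub_sub] using h'
    have h2 : (∫ u in m..z, (Real.smoothTransition (u - t) - Real.smoothTransition (u - t - 1))) =
        ∫ w in (0 : ℝ)..2, (Real.smoothTransition w - Real.smoothTransition (w - 1)) := by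
      have := intervalIntegral.integral_comp_sub_right
        (fun w => Real.smoothTransition w - Real.smoothTransition (w - 1)) t (a := m) (b := z)
      rw [show (fun u : ℝ => Real.smoothTransition (u - t) - Real.smoothTransition (u - t - 1)) =
          fun u : ℝ => Real.smoothTransition (u - t) - Real.smoothTransition (u - t - 1) from rfl]
      have e : (fun u : ℝ => Real.smoothTransition (u - t) - Real.smoothTransition (u - t - 1)) =
          fun u : ℝ => Real.smoothTransition (u - t) - Real.smoothTransition ((u - t) - 1) := rfl
      rw [e, this]
      exact intervalIntegral_smoothTransition_sub_eq (by linarith [min_le_right s t]) (by linarith [le_max_right s t])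
    rw [hfdef, intervalIntegral.integral_sub (hfs.intervalIntegrable m z) (hft.intervalIntegrable m z), h1, h2, sub_self]

/-! ## Bump-window energies are translation invariant -/

/-- The bump-window density `B(x₂ − s)‖V x‖²` is integrable when `‖V‖² ∈ L¹({|x₂| ≤ T})`, `|s| + 2 ≤ T`. [folklore] -/
theorem integrable_bump_window_mul_sq (hV : Continuous V) {T s : ℝ} (hs : |s| + 2 ≤ T)
    (hL2 : Integrable (fun x => {x : EuclideanSpace ℝ (Fin 3) | |x 2| ≤ T}.indicator (fun x => ‖V x‖ ^ 2) x) volume) :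
    Integrable (fun x : EuclideanSpace ℝ (Fin 3) =>
      (Real.smoothTransition (x 2 - s) - Real.smoothTransition (x 2 - s - 1)) * ‖V x‖ ^ 2) volume := by
  refine hL2.mono' ?_ (Eventually.of_forall fun x => ?_)
  · have h2 : Continuous fun x : EuclideanSpace ℝ (Fin 3) => x 2 - s :=
      (PiLp.continuous_apply 2 _ (2 : Fin 3)).sub continuous_const
    have hb : Continuous fun x : EuclideanSpace ℝ (Fin 3) =>
        Real.smoothTransition (x 2 - s) - Real.smoothTransition (x 2 - s - 1) :=
      continuous_smoothTransition_sub.comp h2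
    exact (hb.mul (hV.norm.pow 2)).aestronglyMeasurable
  · rw [Real.norm_eq_abs]
    by_cases hb : Real.smoothTransition (x 2 - s) - Real.smoothTransition (x 2 - s - 1) = 0
    · rw [hb, zero_mul, abs_zero]; exact indicator_nonneg (fun _ _ => sq_nonneg _) _
    · obtain ⟨hl, hu⟩ := pos_and_lt_two_of_smoothTransition_sub_ne_zero hb
      have hx : x ∈ {x : EuclideanSpace ℝ (Fin 3) | |x 2| ≤ T} := by
        show |x 2| ≤ T
        rw [abs_le]; constructor <;> linarith [le_abs_self s, neg_abs_le s]
      rw [indicator_of_mem hx, abs_mul, abs_of_nonneg (sq_nonneg ‖V x‖),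
        abs_of_nonneg (smoothTransition_sub_nonneg _)]
      calc (Real.smoothTransition (x 2 - s) - Real.smoothTransition (x 2 - s - 1)) * ‖V x‖ ^ 2
          ≤ 1 * ‖V x‖ ^ 2 := mul_le_mul_of_nonneg_right (smoothTransition_sub_le_one _) (sq_nonneg _)
        _ = ‖V x‖ ^ 2 := one_mul _

/-- **Bump-window invariance.**  For `V ∈ C¹` divergence free with `⟪V, c⟫ = −‖V‖²/2`, `c = (0,0,c₂) ≠ 0`,
`‖V‖² ∈ L¹({|x₂| ≤ T})`: the bump-window energies `F(s) = ∫ B(x₂ − s)‖V x‖² dx` satisfy **`F(s) = F(t)`** for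
`|s| + 2, |t| + 2 ≤ T`. [folklore] -/
theorem integral_bump_window_mul_sq_eq (hV : ContDiff ℝ 1 V) (hdiv : VectorCalculus.IsDivFree V)
    (hVc : ∀ x, ⟪V x, c⟫ = -(‖V x‖ ^ 2 / 2)) (hc0 : c 0 = 0) (hc1 : c 1 = 0) (hc2 : c 2 ≠ 0)
    {T s t : ℝ} (hs : |s| + 2 ≤ T) (ht : |t| + 2 ≤ T)
    (hL2 : Integrable (fun x => {x : EuclideanSpace ℝ (Fin 3) | |x 2| ≤ T}.indicator (fun x => ‖V x‖ ^ 2) x) volume) :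
    (∫ x, (Real.smoothTransition (x 2 - s) - Real.smoothTransition (x 2 - s - 1)) * ‖V x‖ ^ 2) =
      ∫ x, (Real.smoothTransition (x 2 - t) - Real.smoothTransition (x 2 - t - 1)) * ‖V x‖ ^ 2 := by
  obtain ⟨θ, hθ, hderiv, hlow, hhigh⟩ := exists_axialTest_deriv_eq_bump_sub_bump s t
  have hT : 0 < T := by linarith [abs_nonneg s]
  have hθT : ∀ z, T ≤ |z| → θ z = 0 := by
    intro z hz
    rcases le_abs'.1 hz with h | h
    · exact hlow z (le_min (by linarith [neg_abs_le s]) (by linarith [neg_abs_le t]))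
    · exact hhigh z (by
        rcases le_total s t with hst | hst
        · rw [max_eq_right hst]; linarith [le_abs_self t]
        · rw [max_eq_left hst]; linarith [le_abs_self s])
  have h0 := integral_deriv_axialTest_mul_sq_eq_zero hV hdiv hVc hc0 hc1 hc2 hθ hT hθT hL2
  simp_rw [hderiv, sub_mul (Real.smoothTransition _ - Real.smoothTransition _)
    (Real.smoothTransition _ - Real.smoothTransition _)] at h0
  rw [integral_sub (integrable_bump_window_mul_sq hV.continuous hs hL2)
    (integrable_bump_window_mul_sq hV.continuous ht hL2)] at h0
  linarith

/-! ## Linear growth of the slab energies -/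

/-- Telescoping: `H(z) − H(z − N) = Σ_{k<N} B(z − k)`. [folklore] -/
theorem smoothTransition_sub_eq_sum_bump (z : ℝ) (N : ℕ) :
    Real.smoothTransition z - Real.smoothTransition (z - N) =
      ∑ k ∈ Finset.range N, (Real.smoothTransition (z - k) - Real.smoothTransition (z - k - 1)) := by
  have h := Finset.sum_range_sub' (fun k : ℕ => Real.smoothTransition (z - k)) N
  simp only [Nat.cast_zero, sub_zero, Nat.cast_add, Nat.cast_one] at h
  rw [← h]
  refine Finset.sum_congr rfl fun k _ => ?_
  rw [sub_sub]

/-- Index bookkeeping: `|s + k| + 2 ≤ T` for `k < N` when `|s| + N + 2 ≤ T`. [folklore] -/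
theorem abs_add_natCast_add_two_le {T s : ℝ} {N k : ℕ} (hs : |s| + N + 2 ≤ T) (hk : k ∈ Finset.range N) :
    |s + k| + 2 ≤ T := by
  have hk' : (k : ℝ) ≤ N := by exact_mod_cast (Finset.mem_range.1 hk).le
  have : |s + k| ≤ |s| + k := (abs_add_le _ _).trans (by rw [Nat.abs_cast])
  linarith

/-- The step-window density `(H(x₂ − s) − H(x₂ − s − N))‖V x‖²` is integrable (`|s| + N + 2 ≤ T`). [folklore] -/
theorem integrable_step_window_mul_sq (hV : Continuous V) {T s : ℝ} {N : ℕ} (hs : |s| + N + 2 ≤ T)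
    (hL2 : Integrable (fun x => {x : EuclideanSpace ℝ (Fin 3) | |x 2| ≤ T}.indicator (fun x => ‖V x‖ ^ 2) x) volume) :
    Integrable (fun x : EuclideanSpace ℝ (Fin 3) =>
      (Real.smoothTransition (x 2 - s) - Real.smoothTransition (x 2 - s - N)) * ‖V x‖ ^ 2) volume := by
  have : (fun x : EuclideanSpace ℝ (Fin 3) =>
      (Real.smoothTransition (x 2 - s) - Real.smoothTransition (x 2 - s - N)) * ‖V x‖ ^ 2) =
      fun x => ∑ k ∈ Finset.range N,
        (Real.smoothTransition (x 2 - s - k) - Real.smoothTransition (x 2 - s - k - 1)) * ‖V x‖ ^ 2 := by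
    funext x; rw [smoothTransition_sub_eq_sum_bump (x 2 - s) N, Finset.sum_mul]
  rw [this]
  refine integrable_finsetSum _ fun k hk' => ?_
  have h := integrable_bump_window_mul_sq hV (abs_add_natCast_add_two_le hs hk') hL2
  simpa only [sub_add_eq_sub_sub] using h

/-- **Linear growth of the slab energies.**  For `V ∈ C¹` divergence free with `⟪V, c⟫ = −‖V‖²/2`, `c = (0,0,c₂) ≠ 0`,
`‖V‖² ∈ L¹({|x₂| ≤ T})`, `N ∈ ℕ` and `|s| + N + 2 ≤ T`:
**`∫ (H(x₂ − s) − H(x₂ − s − N))‖V x‖² dx = N · ∫ B(x₂)‖V x‖² dx`** — the step-window `H(· − s) − H(· − s − N)` (equal to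
`1` on `[s+1, s+N]`, supported in `[s, s+N+1]`) carries `N` times the bump-window energy. [folklore] -/
theorem integral_step_window_mul_sq_eq (hV : ContDiff ℝ 1 V) (hdiv : VectorCalculus.IsDivFree V)
    (hVc : ∀ x, ⟪V x, c⟫ = -(‖V x‖ ^ 2 / 2)) (hc0 : c 0 = 0) (hc1 : c 1 = 0) (hc2 : c 2 ≠ 0)
    {T s : ℝ} {N : ℕ} (hs : |s| + N + 2 ≤ T)
    (hL2 : Integrable (fun x => {x : EuclideanSpace ℝ (Fin 3) | |x 2| ≤ T}.indicator (fun x => ‖V x‖ ^ 2) x) volume) :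
    (∫ x, (Real.smoothTransition (x 2 - s) - Real.smoothTransition (x 2 - s - N)) * ‖V x‖ ^ 2) =
      N * ∫ x, (Real.smoothTransition (x 2) - Real.smoothTransition (x 2 - 1)) * ‖V x‖ ^ 2 := by
  have hk : ∀ k ∈ Finset.range N, |s + k| + 2 ≤ T := fun k hk => abs_add_natCast_add_two_le hs hk
  have h0 : |(0 : ℝ)| + 2 ≤ T := by rw [abs_zero]; linarith [abs_nonneg s, (N.cast_nonneg : (0 : ℝ) ≤ N)]
  have hterm : ∀ k ∈ Finset.range N,
      (∫ x : EuclideanSpace ℝ (Fin 3), (Real.smoothTransition (x 2 - s - k) -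
        Real.smoothTransition (x 2 - s - k - 1)) * ‖V x‖ ^ 2) =
      ∫ x, (Real.smoothTransition (x 2) - Real.smoothTransition (x 2 - 1)) * ‖V x‖ ^ 2 := by
    intro k hk'
    have h := integral_bump_window_mul_sq_eq hV hdiv hVc hc0 hc1 hc2 (hk k hk') h0 hL2
    simp only [sub_zero] at h
    simpa only [sub_add_eq_sub_sub] using h
  calc (∫ x, (Real.smoothTransition (x 2 - s) - Real.smoothTransition (x 2 - s - N)) * ‖V x‖ ^ 2)
      = ∫ x : EuclideanSpace ℝ (Fin 3), ∑ k ∈ Finset.range N,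
          (Real.smoothTransition (x 2 - s - k) - Real.smoothTransition (x 2 - s - k - 1)) * ‖V x‖ ^ 2 := by
        refine integral_congr_ae (Eventually.of_forall fun x => ?_)
        show _ = _
        dsimp only
        rw [smoothTransition_sub_eq_sum_bump (x 2 - s) N, Finset.sum_mul]
    _ = ∑ k ∈ Finset.range N, ∫ x : EuclideanSpace ℝ (Fin 3),
          (Real.smoothTransition (x 2 - s - k) - Real.smoothTransition (x 2 - s - k - 1)) * ‖V x‖ ^ 2 := by
        refine integral_finsetSum _ fun k hk' => ?_
        have h := integrable_bump_window_mul_sq hV.continuous (hk k hk') hL2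
        simpa only [sub_add_eq_sub_sub] using h
    _ = ∑ k ∈ Finset.range N, ∫ x : EuclideanSpace ℝ (Fin 3),
          (Real.smoothTransition (x 2) - Real.smoothTransition (x 2 - 1)) * ‖V x‖ ^ 2 :=
        Finset.sum_congr rfl hterm
    _ = N * ∫ x, (Real.smoothTransition (x 2) - Real.smoothTransition (x 2 - 1)) * ‖V x‖ ^ 2 := by
        rw [Finset.sum_const, Finset.card_range, nsmul_eq_mul]


end ExtremiserLiouville

end Summit.NavierStokesRegularity.NavierStokesRegularity.Theorems

end
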